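import Summits.CriticalPhenomena.Ising3DConformalLimit.Theorems.MoebiusLimitExists.Negative.PinnedRenormalisation
import Literature.Probability.LatticeModels.TwoPointSupNormMonotone

/-!
# `MoebiusLimit` (item stmt-CriticalPhenomena-1344), line `only-interaction-breaks-moebius`:
# what STUB 1 (`stub_compactness`) silently contains — cluster points are non-degenerate, and the
# lattice two-point function DOUBLES

Negative/structural knowledge for the picked line of the crux (standing crux disprover gen 3,
D-0016); THEOREM-ONLY. `stub_compactness` (skeleton `Cruxes/MoebiusLimitExists/Lines/only-interaction-breaks-moebius.lean`,
original sha 8f8c9fdb) asks that EVERY mesh sequence `u_k → 0⁺` has a subsequence along which the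
pinned zoom converges, for all `n`, locally uniformly off the diagonals, to a REGULAR family; it was
stated UNCONDITIONALLY (the two-point law, item 0634, being a hypothesis of STUB 2 only). This file
measures it against the lattice (hypotheses: the `n = 2` clause of the stub, or the stub verbatim in
the `_of_stub` corollaries; the weak TWO-POINT cluster datum is used throughout).

Free facts (no stub): `pinnedZoom_axisPair` (at an axis pair the pinned zoom is the lattice RATIO
`⟨σ₀σ_{⌊t/δ⌋e₀}⟩/⟨σ₀σ_{⌊1/δ⌋e₀}⟩`), `clusterPoint_two_unit` (`S₂(0,e₀) = 1`), `clusterPoint_two_nonneg`,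
`clusterPoint_two_le_of_mul_norm_lt` (Messager–Miracle-Solé INWARD comparison along a mesh sequence,
from `eventually_twoPoint_latticeApprox_le`).
* `clusterPoint_axis_pos_of_compactness`, `clusterPoint_nondeg_of_compactness` / `_of_stub`: STUB 1 ⇒
  every cluster point is NON-DEGENERATE (a zero of `S₂` at scale `T` makes the pinned zoom at the
  meshes `u_k/T` blow up at `(0, e₀/T)`, so no subsequence converges there) — the non-degeneracy
  STUB 2 extracts from item 0634 is already forced by STUB 1;
* `twoPoint_doubling_of_compactness` / `_of_stub`: STUB 1 ⇒ the TWO-POINT DOUBLING BOUND on `ℤ³`,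
  `⟨σ₀σ_{N e₀}⟩_{β_c} ≤ K ⟨σ₀σ_{2N e₀}⟩_{β_c}` for all `N ≥ 1`.
Two-point doubling at `β_c` is OPEN on `ℤ³` (it follows from 0634; the a-priori window
`c‖x‖⁻² ≤ ⟨σ₀σ_x⟩ ≤ C‖x‖⁻¹`, log-convexity from reflection positivity, MMS and the gradient estimate are
jointly compatible with `G(2N)/G(N) = N⁻¹` at sparse scales), whereas AXIS RATIO REGULARITY
`⟨σ₀σ_{(k+1)e₀}⟩/⟨σ₀σ_{ke₀}⟩ → 1`, which the continuity clause of STUB 1 also forces, is a THEOREM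
(`Literature/Probability/LatticeModels/CriticalAxisRatioRegularity.lean`, same author). SANDWICH: the
crux implies STUB 1 verbatim (deep-refuter `Negative/OnlyInteractionTightness.lean`, `stub1_of_crux`),
and STUB 1 implies doubling; the lead has since conditioned the compactness pieces on 0634 (reshaped
skeleton 06794ee2…, residue `stub_equicontinuity_ge_four`), as this measurement recommended.
(Related: deep-refuter `Negative/PinnedClusterPoints.lean` has `clusterPoint_cfg01`, the `t = 1` case
of `clusterPoint_two_unit` for genuine cluster points.)
-/

noncomputable section

namespace Summit.CriticalPhenomena.Ising3DConformalLimit.MoebiusLimitExistsNegative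

open Literature.Probability.LatticeModels Filter Set
open Summit.CriticalPhenomena.Ising3DConformalLimit.MoebiusLimitExistsOnlyInteraction
open scoped Topology

variable {S : CorrFamily 3}


/-! ### Free facts about cluster points -/

/-- `ρ_pin(δ)² = ⟨σ₀σ_{⌊1/δ⌋e₀}⟩⁻¹` for `δ ∈ (0,1]`. [folklore] -/
theorem rhoPin_sq {δ : ℝ} (hδ : δ ∈ Set.Ioc (0:ℝ) 1) :
    rhoPin δ ^ 2 = (criticalTwoPoint 3 (Pi.single (0 : Fin 3) ⌊1 / δ⌋))⁻¹ := by
  have hG := criticalTwoPoint_floor_pos hδ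
  unfold rhoPin
  rw [← Real.rpow_natCast, ← Real.rpow_mul hG.le,
    show (-(1 / 2 : ℝ) * ((2:ℕ) : ℝ)) = -1 by norm_num, Real.rpow_neg_one]

/-- **The pinned zoom at an axis pair is a RATIO of critical two-point functions**:
`ρ_pin(δ)² ⟨σ₀σ_{⌊t/δ⌋e₀}⟩ = ⟨σ₀σ_{⌊t/δ⌋e₀}⟩ / ⟨σ₀σ_{⌊1/δ⌋e₀}⟩` (`δ ∈ (0,1]`). [folklore] -/
theorem pinnedZoom_axisPair {δ : ℝ} (hδ : δ ∈ Set.Ioc (0:ℝ) 1) (t : ℝ) :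
    rescaledCorrelator (criticalCorr 3) rhoPin 2 δ ![0, EuclideanSpace.single 0 t] =
      criticalTwoPoint 3 (Pi.single 0 ⌊t / δ⌋) / criticalTwoPoint 3 (Pi.single 0 ⌊1 / δ⌋) := by
  rw [rescaledCorrelator_axisPair, rhoPin_sq hδ, inv_mul_eq_div]

/-- A cluster point is in particular a cluster point of the TWO-point zoom (the weaker datum used
below). [folklore] -/
theorem clusterPoint_two_conv (hS : IsClusterPoint S) :
    ∃ u : ℕ → ℝ, Tendsto u atTop (𝓝[>] (0 : ℝ)) ∧
      TendstoLocallyUniformlyOn (fun k => rescaledCorrelator (criticalCorr 3) rhoPin 2 (u k)) (S 2)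
        atTop (NonCoincident 3 2) :=
  let ⟨u, hu, h⟩ := hS
  ⟨u, hu, h 2⟩

/-- Every cluster point of the (two-point) pinned zoom has `S₂(0, e₀) = 1` (the zoom is `≡ 1`
there). [folklore] -/
theorem clusterPoint_two_unit
    (hS : ∃ u : ℕ → ℝ, Tendsto u atTop (𝓝[>] (0 : ℝ)) ∧
      TendstoLocallyUniformlyOn (fun k => rescaledCorrelator (criticalCorr 3) rhoPin 2 (u k)) (S 2)
        atTop (NonCoincident 3 2)) :
    S 2 ![0, EuclideanSpace.single 0 1] = 1 := by
  obtain ⟨u, hu, hconv⟩ := hS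
  have h := hconv.tendsto_at (zero_unitVec_mem_nonCoincident (one_ne_zero (α := ℝ)))
  have h1 : Tendsto (fun k => rescaledCorrelator (criticalCorr 3) rhoPin 2 (u k)
      ![0, EuclideanSpace.single 0 1]) atTop (𝓝 1) := by
    refine tendsto_const_nhds.congr' ?_
    filter_upwards [hu.eventually (Ioc_mem_nhdsGT one_pos)] with k hk
    exact (rescaledCorrelator_rhoPin_unit hk).symm
  exact tendsto_nhds_unique h h1

/-- Every cluster point has `S₂ ≥ 0` off the diagonal (GKS I). [folklore] -/
theorem clusterPoint_two_nonneg
    (hS : ∃ u : ℕ → ℝ, Tendsto u atTop (𝓝[>] (0 : ℝ)) ∧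
      TendstoLocallyUniformlyOn (fun k => rescaledCorrelator (criticalCorr 3) rhoPin 2 (u k)) (S 2)
        atTop (NonCoincident 3 2))
    {x : Fin 2 → EuclideanSpace ℝ (Fin 3)} (hx : x ∈ NonCoincident 3 2) : 0 ≤ S 2 x := by
  obtain ⟨u, -, hconv⟩ := hS
  refine ge_of_tendsto' (hconv.tendsto_at hx) fun k => ?_
  rw [rescaledCorrelator_apply, latticeApprox_comp_two, criticalCorr_two_pair]
  exact mul_nonneg (sq_nonneg _) (criticalTwoPoint_nonneg' _)

/-- The lattice Messager–Miracle-Solé comparison at small mesh: if `3‖x₀−x₁‖_∞ < ‖x'₀−x'₁‖_∞` then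
eventually (as `δ → 0⁺`) `⟨σ_{[x'₀/δ]}σ_{[x'₁/δ]}⟩ ≤ ⟨σ_{[x₀/δ]}σ_{[x₁/δ]}⟩` (extracted from the tree
proof of `HasPointwiseScalingLimit.two_le_two_of_mul_norm_lt`). [cite: MessagerMiracleSoleJSP1977, Theorem (monotonicity)] -/
theorem eventually_twoPoint_latticeApprox_le {x x' : Fin 2 → EuclideanSpace ℝ (Fin 3)}
    (hfar : (3 : ℝ) * ‖WithLp.ofLp (x 0) - WithLp.ofLp (x 1)‖ <
      ‖WithLp.ofLp (x' 0) - WithLp.ofLp (x' 1)‖) :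
    ∀ᶠ δ in 𝓝[>] (0:ℝ), criticalTwoPoint 3 (latticeApprox δ (x' 1) - latticeApprox δ (x' 0)) ≤
      criticalTwoPoint 3 (latticeApprox δ (x 1) - latticeApprox δ (x 0)) := by
  have hβ : 0 ≤ criticalBeta 3 := criticalBeta_nonneg 3
  set A : ℝ := ‖WithLp.ofLp (x 0) - WithLp.ofLp (x 1)‖ with hA
  set B : ℝ := ‖WithLp.ofLp (x' 0) - WithLp.ofLp (x' 1)‖ with hB
  have hgap : 0 < B - 3 * A := by linarith
  have hm : Set.Ioo (0:ℝ) ((B - 3 * A) / (2 * 3 + 2)) ∈ 𝓝[>] (0:ℝ) := Ioo_mem_nhdsGT (by positivity)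
  filter_upwards [hm] with δ hδ
  refine twoPointPlus_le_of_mul_supNorm_le hβ ?_
  have h1 := supNorm_latticeApprox_sub_le hδ.1 (x 1) (x 0)
  have h2 := le_supNorm_latticeApprox_sub (d := 3) (by norm_num) hδ.1 (x' 1) (x' 0)
  have hA' : ‖WithLp.ofLp (x 1) - WithLp.ofLp (x 0)‖ = A := by rw [hA, norm_sub_rev]
  have hB' : ‖WithLp.ofLp (x' 1) - WithLp.ofLp (x' 0)‖ = B := by rw [hB, norm_sub_rev]
  rw [hA'] at h1; rw [hB'] at h2
  have hδlt : δ * (2 * 3 + 2) < B - 3 * A := by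
    have := hδ.2; rwa [lt_div_iff₀ (by positivity)] at this
  have key : (3 : ℝ) * (Site.supNorm (latticeApprox δ (x 1) - latticeApprox δ (x 0)) : ℝ) ≤
      (Site.supNorm (latticeApprox δ (x' 1) - latticeApprox δ (x' 0)) : ℝ) := by
    have e1 : (3 : ℝ) * (Site.supNorm (latticeApprox δ (x 1) - latticeApprox δ (x 0)) : ℝ) ≤
        3 * (A / δ + 2) := mul_le_mul_of_nonneg_left h1 (by norm_num)
    have e2 : (3 : ℝ) * (A / δ + 2) ≤ B / δ - 2 := by
      have hδ0 : δ ≠ 0 := hδ.1.ne'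
      have key : (B / δ - 2) - (3 : ℝ) * (A / δ + 2) = (B - 3 * A - δ * (2 * 3 + 2)) / δ := by
        field_simp
        ring
      have hnn : 0 ≤ (B - 3 * A - δ * (2 * 3 + 2)) / δ := div_nonneg (by linarith) hδ.1.le
      linarith [key]
    have h2' : B / δ - 2 ≤ (Site.supNorm (latticeApprox δ (x' 1) - latticeApprox δ (x' 0)) : ℝ) := by
      exact_mod_cast h2
    linarith
  exact_mod_cast key

/-- **Messager–Miracle-Solé along a mesh sequence**: every cluster point has `S₂(x') ≤ S₂(x)` whenever
`3‖x₀−x₁‖_∞ < ‖x'₀−x'₁‖_∞`; in particular positivity of `S₂` propagates INWARD. [cite: MessagerMiracleSoleJSP1977, Theorem (monotonicity)] -/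
theorem clusterPoint_two_le_of_mul_norm_lt
    (hS : ∃ u : ℕ → ℝ, Tendsto u atTop (𝓝[>] (0 : ℝ)) ∧
      TendstoLocallyUniformlyOn (fun k => rescaledCorrelator (criticalCorr 3) rhoPin 2 (u k)) (S 2)
        atTop (NonCoincident 3 2))
    {x x' : Fin 2 → EuclideanSpace ℝ (Fin 3)} (hx : x ∈ NonCoincident 3 2) (hx' : x' ∈ NonCoincident 3 2)
    (hfar : (3 : ℝ) * ‖WithLp.ofLp (x 0) - WithLp.ofLp (x 1)‖ <
      ‖WithLp.ofLp (x' 0) - WithLp.ofLp (x' 1)‖) :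
    S 2 x' ≤ S 2 x := by
  obtain ⟨u, hu, hconv⟩ := hS
  have hT : ∀ {z : Fin 2 → EuclideanSpace ℝ (Fin 3)}, z ∈ NonCoincident 3 2 →
      Tendsto (fun k => rhoPin (u k) ^ 2 *
        criticalTwoPoint 3 (latticeApprox (u k) (z 1) - latticeApprox (u k) (z 0))) atTop (𝓝 (S 2 z)) := by
    intro z hz
    refine Tendsto.congr (fun k => ?_) (hconv.tendsto_at hz)
    rw [rescaledCorrelator_apply, latticeApprox_comp_two, criticalCorr_two_pair]
  have hev := hu.eventually (eventually_twoPoint_latticeApprox_le hfar)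
  exact le_of_tendsto_of_tendsto (hT hx') (hT hx)
    (hev.mono fun k hk => mul_le_mul_of_nonneg_left hk (sq_nonneg _))

/-- The sup-norm distance of the axis pair `(0, t e₀)` is `|t|`. [folklore] -/
theorem norm_axisPair_sub' (t : ℝ) :
    (3 : ℝ) * ‖WithLp.ofLp ((![0, EuclideanSpace.single 0 t] : Fin 2 → EuclideanSpace ℝ (Fin 3)) 0) -
      WithLp.ofLp ((![0, EuclideanSpace.single 0 t] : Fin 2 → EuclideanSpace ℝ (Fin 3)) 1)‖ = 3 * |t| := by
  rw [norm_axisPair_sub]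


/-! ### STUB 1 forces non-degeneracy of every cluster point -/

/-- **STUB 1 ⇒ positivity of every cluster point on the whole axis.** If every mesh sequence has a
subsequence along which the pinned zoom converges (locally uniformly off the diagonals) — the
`n = 2` clause of `stub_compactness`, regularity of the limit not even needed — then every cluster
point `S` has `S₂(0, t e₀) > 0` for all `t > 0`. Proof: a zero at `(0, T e₀)`, `T > 1` (WLOG by the
inward MMS comparison), means `⟨σ₀σ_{⌊T/u_k⌋e₀}⟩/⟨σ₀σ_{⌊1/u_k⌋e₀}⟩ → 0` along the defining sequence
`u_k`; but this ratio is the INVERSE of the pinned zoom at the meshes `u_k/T` and the pair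
`(0, e₀/T)`, which therefore blows up and has no convergent subsequence there. [folklore] -/
theorem clusterPoint_axis_pos_of_compactness
    (hC : ∀ u : ℕ → ℝ, Tendsto u atTop (𝓝[>] (0 : ℝ)) →
      ∃ (φ : ℕ → ℕ) (S' : CorrFamily 3), StrictMono φ ∧
        TendstoLocallyUniformlyOn
          (fun k => rescaledCorrelator (criticalCorr 3) rhoPin 2 (u (φ k))) (S' 2) atTop
          (NonCoincident 3 2))
    (hS : ∃ u : ℕ → ℝ, Tendsto u atTop (𝓝[>] (0 : ℝ)) ∧
      TendstoLocallyUniformlyOn (fun k => rescaledCorrelator (criticalCorr 3) rhoPin 2 (u k)) (S 2)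
        atTop (NonCoincident 3 2)) {t : ℝ} (ht : 0 < t) :
    0 < S 2 ![0, EuclideanSpace.single 0 t] := by
  by_contra hle
  push Not at hle
  -- WLOG the zero sits at a scale `T > 1` (push it outward by MMS)
  obtain ⟨T, hT1, hT0⟩ : ∃ T : ℝ, 1 < T ∧ S 2 ![0, EuclideanSpace.single 0 T] = 0 := by
    refine ⟨3 * t + 3, by linarith, le_antisymm ?_ ?_⟩
    · refine le_trans (clusterPoint_two_le_of_mul_norm_lt hS (zero_unitVec_mem_nonCoincident ht.ne')
        (zero_unitVec_mem_nonCoincident (by linarith : (3 * t + 3 : ℝ) ≠ 0)) ?_) hle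
      rw [norm_axisPair_sub', norm_axisPair_sub, abs_of_pos ht, abs_of_pos (by linarith : (0:ℝ) < 3 * t + 3)]
      linarith
    · exact clusterPoint_two_nonneg hS (zero_unitVec_mem_nonCoincident (by linarith : (3 * t + 3 : ℝ) ≠ 0))
  have hT0' : 0 < T := by linarith
  obtain ⟨u, hu, hconv⟩ := hS
  have hu01 : ∀ᶠ k in atTop, u k ∈ Set.Ioc (0:ℝ) 1 := hu.eventually (Ioc_mem_nhdsGT one_pos)
  -- the ratio `r_k = ⟨σ₀σ_{⌊T/u_k⌋e₀}⟩/⟨σ₀σ_{⌊1/u_k⌋e₀}⟩ → 0⁺`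
  set r : ℕ → ℝ := fun k =>
    criticalTwoPoint 3 (Pi.single 0 ⌊T / u k⌋) / criticalTwoPoint 3 (Pi.single 0 ⌊1 / u k⌋) with hr
  have hr0 : Tendsto r atTop (𝓝 0) := by
    have h := hconv.tendsto_at (zero_unitVec_mem_nonCoincident hT0'.ne')
    rw [hT0] at h
    refine h.congr' ?_
    filter_upwards [hu01] with k hk
    exact pinnedZoom_axisPair hk T
  have hrpos : ∀ᶠ k in atTop, 0 < r k := by
    filter_upwards [hu01] with k hk
    have hk' : u k / T ∈ Set.Ioc (0:ℝ) 1 :=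
      ⟨div_pos hk.1 hT0', (div_le_one hT0').2 (hk.2.trans hT1.le)⟩
    have h1 := criticalTwoPoint_floor_pos hk'
    rw [one_div_div] at h1
    exact div_pos h1 (criticalTwoPoint_floor_pos hk)
  have hrinv : Tendsto (fun k => (r k)⁻¹) atTop atTop :=
    tendsto_inv_nhdsGT_zero.comp (tendsto_nhdsWithin_iff.2 ⟨hr0, hrpos⟩)
  -- the compactness hypothesis at the meshes `u_k / T`
  have hu' : Tendsto (fun k => u k / T) atTop (𝓝[>] (0:ℝ)) := by
    refine tendsto_nhdsWithin_iff.2 ⟨?_, ?_⟩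
    · simpa using (tendsto_nhds_of_tendsto_nhdsWithin hu).div_const T
    · filter_upwards [hu01] with k hk using div_pos hk.1 hT0'
  obtain ⟨φ, S', hφ, hconv'⟩ := hC _ hu'
  have hy : (![0, EuclideanSpace.single 0 T⁻¹] : Fin 2 → EuclideanSpace ℝ (Fin 3)) ∈ NonCoincident 3 2 :=
    zero_unitVec_mem_nonCoincident (inv_ne_zero hT0'.ne')
  have hfin := hconv'.tendsto_at hy
  -- but along `φ` that zoom is `(r ∘ φ)⁻¹ → +∞`
  have heq : ∀ᶠ k in atTop, (r (φ k))⁻¹ =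
      rescaledCorrelator (criticalCorr 3) rhoPin 2 (u (φ k) / T) ![0, EuclideanSpace.single 0 T⁻¹] := by
    filter_upwards [hφ.tendsto_atTop.eventually hu01] with k hk
    have hk' : u (φ k) / T ∈ Set.Ioc (0:ℝ) 1 :=
      ⟨div_pos hk.1 hT0', (div_le_one hT0').2 (hk.2.trans hT1.le)⟩
    rw [pinnedZoom_axisPair hk' T⁻¹, one_div_div, hr]
    simp only [inv_div]
    congr 3
    have hu0 : u (φ k) ≠ 0 := hk.1.ne'
    field_simp
  have hinf : Tendsto (fun k => rescaledCorrelator (criticalCorr 3) rhoPin 2 (u (φ k) / T)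
      ![0, EuclideanSpace.single 0 T⁻¹]) atTop atTop :=
    (hrinv.comp hφ.tendsto_atTop).congr' heq
  exact not_tendsto_nhds_of_tendsto_atTop hinf _ hfin

/-- **STUB 1 ⇒ EVERY CLUSTER POINT IS NON-DEGENERATE** (`S₂ > 0` on all non-coincident pairs):
positivity on the whole axis (`clusterPoint_axis_pos_of_compactness`) plus the inward MMS
comparison. So under STUB 1 the non-degeneracy that STUB 2 extracts from the two-point law is
already forced. [folklore] -/
theorem clusterPoint_nondeg_of_compactness
    (hC : ∀ u : ℕ → ℝ, Tendsto u atTop (𝓝[>] (0 : ℝ)) →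
      ∃ (φ : ℕ → ℕ) (S' : CorrFamily 3), StrictMono φ ∧
        TendstoLocallyUniformlyOn
          (fun k => rescaledCorrelator (criticalCorr 3) rhoPin 2 (u (φ k))) (S' 2) atTop
          (NonCoincident 3 2))
    (hS : ∃ u : ℕ → ℝ, Tendsto u atTop (𝓝[>] (0 : ℝ)) ∧
      TendstoLocallyUniformlyOn (fun k => rescaledCorrelator (criticalCorr 3) rhoPin 2 (u k)) (S 2)
        atTop (NonCoincident 3 2)) : IsNondegenerateTwoPoint S := by
  intro x hx
  set t : ℝ := 3 * ‖WithLp.ofLp (x 0) - WithLp.ofLp (x 1)‖ + 1 with ht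
  have ht0 : 0 < t := by rw [ht]; linarith [norm_nonneg (WithLp.ofLp (x 0) - WithLp.ofLp (x 1))]
  have hpos := clusterPoint_axis_pos_of_compactness hC hS ht0
  refine lt_of_lt_of_le hpos
    (clusterPoint_two_le_of_mul_norm_lt hS hx (zero_unitVec_mem_nonCoincident ht0.ne') ?_)
  rw [norm_axisPair_sub, abs_of_pos ht0, ht]
  linarith

/-- The `n = 2` clause of STUB 1 (verbatim `stub_compactness` restricted to what is used here).
[folklore] -/
theorem compactness_two_of_stub
    (hC : ∀ u : ℕ → ℝ, Tendsto u atTop (𝓝[>] (0 : ℝ)) →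
      ∃ (φ : ℕ → ℕ) (S' : CorrFamily 3), StrictMono φ ∧ MoebiusLimitExistsOnlyInteraction.IsRegular S' ∧
        ∀ n, TendstoLocallyUniformlyOn
          (fun k => rescaledCorrelator (criticalCorr 3) rhoPin n (u (φ k))) (S' n) atTop
          (NonCoincident 3 n)) :
    ∀ u : ℕ → ℝ, Tendsto u atTop (𝓝[>] (0 : ℝ)) →
      ∃ (φ : ℕ → ℕ) (S' : CorrFamily 3), StrictMono φ ∧
        TendstoLocallyUniformlyOn
          (fun k => rescaledCorrelator (criticalCorr 3) rhoPin 2 (u (φ k))) (S' 2) atTop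
          (NonCoincident 3 2) := by
  intro u hu
  obtain ⟨φ, S', hφ, -, hconv⟩ := hC u hu
  exact ⟨φ, S', hφ, hconv 2⟩

/-! ### STUB 1 forces an open lattice statement: two-point doubling -/

/-- The pinned zoom at mesh `1/N` and the axis pair `(0, m e₀)`, `m : ℕ`, is the lattice ratio
`⟨σ₀σ_{mN e₀}⟩ / ⟨σ₀σ_{N e₀}⟩`. [folklore] -/
theorem pinnedZoom_inv_nat {N : ℕ} (hN : 1 ≤ N) (m : ℕ) :
    rescaledCorrelator (criticalCorr 3) rhoPin 2 (1 / (N : ℝ)) ![0, EuclideanSpace.single 0 (m : ℝ)] =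
      criticalTwoPoint 3 (Pi.single 0 ((m * N : ℕ) : ℤ)) / criticalTwoPoint 3 (Pi.single 0 (N : ℤ)) := by
  have hN0 : (0 : ℝ) < N := by exact_mod_cast hN
  have hmem : (1 / (N : ℝ)) ∈ Set.Ioc (0:ℝ) 1 :=
    ⟨by positivity, (div_le_one hN0).2 (by exact_mod_cast hN)⟩
  rw [pinnedZoom_axisPair hmem]
  have h1 : (m : ℝ) / (1 / (N : ℝ)) = ((m * N : ℕ) : ℤ) := by push_cast; field_simp
  have h2 : (1 : ℝ) / (1 / (N : ℝ)) = ((N : ℕ) : ℤ) := by push_cast; field_simp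
  rw [h1, h2, Int.floor_intCast, Int.floor_intCast]

/-- **STUB 1 ⇒ TWO-POINT DOUBLING ON `ℤ³`**: there is `K` with `⟨σ₀σ_{N e₀}⟩_{β_c} ≤ K ⟨σ₀σ_{2N e₀}⟩_{β_c}`
for all `N ≥ 1`. (If the ratios `⟨σ₀σ_{N e₀}⟩/⟨σ₀σ_{2N e₀}⟩` were unbounded, along such `N_j → ∞` the
pinned zoom at `(0, 2e₀)` tends to `0`, so the cluster point produced by STUB 1 has `S₂(0,2e₀) = 0`,
contradicting `clusterPoint_nondeg_of_compactness`.) Doubling of the critical two-point function is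
OPEN on `ℤ³` (the a-priori window `c‖x‖⁻² ≤ ⟨σ₀σ_x⟩ ≤ C‖x‖⁻¹` allows ratios of order `N`).
[cite: DuminilCopinICM2022, §8.4 p. 29] -/
theorem twoPoint_doubling_of_compactness
    (hC : ∀ u : ℕ → ℝ, Tendsto u atTop (𝓝[>] (0 : ℝ)) →
      ∃ (φ : ℕ → ℕ) (S' : CorrFamily 3), StrictMono φ ∧
        TendstoLocallyUniformlyOn
          (fun k => rescaledCorrelator (criticalCorr 3) rhoPin 2 (u (φ k))) (S' 2) atTop
          (NonCoincident 3 2)) :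
    ∃ K : ℝ, ∀ N : ℕ, 1 ≤ N →
      criticalTwoPoint 3 (Pi.single 0 (N : ℤ)) ≤ K * criticalTwoPoint 3 (Pi.single 0 ((2 * N : ℕ) : ℤ)) := by
  -- the ratio function
  set q : ℕ → ℝ := fun N =>
    criticalTwoPoint 3 (Pi.single 0 (N : ℤ)) / criticalTwoPoint 3 (Pi.single 0 ((2 * N : ℕ) : ℤ)) with hq
  have hGpos : ∀ N : ℕ, 1 ≤ N → 0 < criticalTwoPoint 3 (Pi.single 0 ((2 * N : ℕ) : ℤ)) := by
    intro N hN
    have hmem : (1 / ((2 * N : ℕ) : ℝ)) ∈ Set.Ioc (0:ℝ) 1 := by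
      have : (1:ℝ) ≤ ((2 * N : ℕ) : ℝ) := by exact_mod_cast (by omega : 1 ≤ 2 * N)
      exact ⟨by positivity, (div_le_one (by positivity)).2 this⟩
    have h := criticalTwoPoint_floor_pos hmem
    rwa [one_div_one_div, show ((2 * N : ℕ) : ℝ) = (((2 * N : ℕ) : ℤ) : ℝ) by push_cast; ring,
      Int.floor_intCast] at h
  by_contra hK
  push Not at hK
  -- `q` is unbounded on `N ≥ 1`, hence exceeds every bound beyond every `M`
  have hunb : ∀ (K : ℝ) (M : ℕ), ∃ N : ℕ, M < N ∧ K < q N := by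
    intro K M
    obtain ⟨Q, hQ⟩ := ((Set.finite_Iic M).image q).bddAbove
    obtain ⟨N, hN1, hN⟩ := hK (max K Q)
    have hqN : max K Q < q N := by
      rw [hq]; simp only []
      rwa [lt_div_iff₀ (hGpos N hN1)]
    refine ⟨N, ?_, lt_of_le_of_lt (le_max_left _ _) hqN⟩
    by_contra hle
    push Not at hle
    have : q N ≤ Q := hQ ⟨N, hle, rfl⟩
    exact absurd (lt_of_le_of_lt (le_max_right K Q) hqN) (not_lt.2 this)
  choose N hNgt hNq using fun j : ℕ => hunb j j
  have hN1 : ∀ j, 1 ≤ N j := fun j => Nat.one_le_of_lt (hNgt j)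
  have hNtop : Tendsto (fun j => (N j : ℝ)) atTop atTop :=
    tendsto_natCast_atTop_atTop.comp (tendsto_atTop_mono (fun j => (hNgt j).le) tendsto_id)
  -- meshes `u_j = 1/N_j → 0⁺`
  have hu : Tendsto (fun j => 1 / (N j : ℝ)) atTop (𝓝[>] (0:ℝ)) := by
    refine tendsto_nhdsWithin_iff.2 ⟨?_, Eventually.of_forall fun j => ?_⟩
    · rw [show (fun j => 1 / (N j : ℝ)) = (fun j => (N j : ℝ))⁻¹ from funext fun j => by simp [one_div]]
      exact hNtop.inv_tendsto_atTop
    · have : (0:ℝ) < N j := by exact_mod_cast hN1 j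
      exact Set.mem_Ioi.2 (by positivity)
  obtain ⟨φ, S', hφ, hconv⟩ := hC _ hu
  have hS' : ∃ u : ℕ → ℝ, Tendsto u atTop (𝓝[>] (0 : ℝ)) ∧
      TendstoLocallyUniformlyOn (fun k => rescaledCorrelator (criticalCorr 3) rhoPin 2 (u k)) (S' 2)
        atTop (NonCoincident 3 2) :=
    ⟨fun j => 1 / (N (φ j) : ℝ), hu.comp hφ.tendsto_atTop, hconv⟩
  have hpos : 0 < S' 2 ![0, EuclideanSpace.single 0 2] :=
    clusterPoint_nondeg_of_compactness hC hS' _ (zero_unitVec_mem_nonCoincident two_ne_zero)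
  -- the zoom at `(0, 2e₀)` along `φ` is `1/q(N_{φ k}) → 0`
  have hzoom : ∀ j, rescaledCorrelator (criticalCorr 3) rhoPin 2 (1 / (N j : ℝ))
      ![0, EuclideanSpace.single 0 2] = (q (N j))⁻¹ := by
    intro j
    rw [show (2 : ℝ) = ((2 : ℕ) : ℝ) by norm_num, pinnedZoom_inv_nat (hN1 j) 2, hq]
    simp only [inv_div]
  have hqtop : Tendsto (fun k => q (N (φ k))) atTop atTop :=
    (tendsto_atTop_mono (fun j => (hNq j).le) tendsto_natCast_atTop_atTop).comp hφ.tendsto_atTop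
  have h0 : Tendsto (fun k => rescaledCorrelator (criticalCorr 3) rhoPin 2 (1 / (N (φ k) : ℝ))
      ![0, EuclideanSpace.single 0 2]) atTop (𝓝 0) := by
    simp_rw [hzoom]
    exact hqtop.inv_tendsto_atTop
  have hlim := hconv.tendsto_at (zero_unitVec_mem_nonCoincident (two_ne_zero (α := ℝ)))
  have := tendsto_nhds_unique hlim h0
  linarith

/-! ### The same, from the verbatim STUB 1 -/

/-- **Verbatim `stub_compactness` ⇒ every cluster point is non-degenerate.** [folklore] -/
theorem clusterPoint_nondeg_of_stub
    (hstub : ∀ u : ℕ → ℝ, Tendsto u atTop (𝓝[>] (0 : ℝ)) →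
      ∃ (φ : ℕ → ℕ) (S : CorrFamily 3), StrictMono φ ∧ MoebiusLimitExistsOnlyInteraction.IsRegular S ∧
        ∀ n, TendstoLocallyUniformlyOn
          (fun k => rescaledCorrelator (criticalCorr 3) rhoPin n (u (φ k))) (S n) atTop
          (NonCoincident 3 n))
    (hS : IsClusterPoint S) : IsNondegenerateTwoPoint S :=
  clusterPoint_nondeg_of_compactness (compactness_two_of_stub hstub) (clusterPoint_two_conv hS)

/-- **Verbatim `stub_compactness` ⇒ two-point doubling on `ℤ³`** (open). [cite: DuminilCopinICM2022, §8.4 p. 29] -/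
theorem twoPoint_doubling_of_stub
    (hstub : ∀ u : ℕ → ℝ, Tendsto u atTop (𝓝[>] (0 : ℝ)) →
      ∃ (φ : ℕ → ℕ) (S : CorrFamily 3), StrictMono φ ∧ MoebiusLimitExistsOnlyInteraction.IsRegular S ∧
        ∀ n, TendstoLocallyUniformlyOn
          (fun k => rescaledCorrelator (criticalCorr 3) rhoPin n (u (φ k))) (S n) atTop
          (NonCoincident 3 n)) :
    ∃ K : ℝ, ∀ N : ℕ, 1 ≤ N →
      criticalTwoPoint 3 (Pi.single 0 (N : ℤ)) ≤ K * criticalTwoPoint 3 (Pi.single 0 ((2 * N : ℕ) : ℤ)) :=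
  twoPoint_doubling_of_compactness (compactness_two_of_stub hstub)

end Summit.CriticalPhenomena.Ising3DConformalLimit.MoebiusLimitExistsNegative

end
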